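import Summits.RiemannHypothesis.RiemannHypothesis.Theorems.SoloInformedGroundStateVisibility
import Summits.RiemannHypothesis.RiemannHypothesis.Theorems.SoloInformedGroundStateNearNull
import Literature.NumberTheory.LFunctions.WeilWindowSuzukiContinuityProofs

/-!
# Ground-state endgame, V-e: the visibility criterion is an equivalence

Solo programme `solo-RiemannHypothesis-informed`, session 3 (part 5 of the operator-free endgame).

Part 3 proved `RiemannHypothesis` from VISIBLE NEAR-MINIMISERS: `δ < 1` and, on every large
window `[-a, a]`, a normalised test `g` with `Re Q(g) ≤ ε(a) + s`, within `L²`-distance `√δ` of a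
window test `k` whose `ℓ¹` zero sum has `4 Z₁(k; ·) E(a) + s ≤ B` (`E(a) = e^{a/2}√(2a)`), or
`≤ B e^{κa}` for every `κ > 0`.  Part 4 produced, unconditionally, unit window tests `k_a` with
`Z₁(k_a; ·) E(a) ≤ C`.  Here the converse is recorded: under `RiemannHypothesis` the vectors
`g = k = k_a` themselves satisfy the hypothesis with `δ = 0` and `B = 5C`
(`visible_near_minimisers_of_riemannHypothesis`): Weil's criterion gives `ε(a) ≥ 0`
(`weilGroundEnergy_nonneg_of_riemannHypothesis`, part I of the programme), while the
`ℓ¹` pairing bounds `Re Q(k_a) ≤ |Q(k_a)| ≤ Z₁ E ‖k_a‖₂ ≤ C`, so `k_a` is a near-minimiser with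
slack `s = Re Q(k_a) − ε(a) ∈ [0, C]`.  Hence

  `RiemannHypothesis ↔ ∃ δ < 1, ∃ B a₀, ∀ a ≥ a₀, (visible near-minimiser data)`

(`riemannHypothesis_iff_visible_near_minimisers`, and the subexponential form
`riemannHypothesis_iff_visible_near_minimisers_subexp`): the criterion is exactly of the strength
of the Riemann hypothesis, and its content is the DICHOTOMY it isolates — either near-minimisers
of the Weil form on large windows can be taken `L²`-close to `ℓ¹`-near-null vectors (RH), or the
ground energy is negative and every near-null vector is asymptotically invisible from the ground
state (part 2, `one_sub_le_dist_sq_of_weilGroundEnergy_neg`).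
-/

noncomputable section

open Complex Filter Set Topology Metric MeasureTheory
open Literature.NumberTheory.LFunctions Literature.NumberTheory.LFunctions.WeilContinuous
open scoped ComplexConjugate

namespace Summit.RiemannHypothesis.RiemannHypothesis.Theorems

section Equivalence

/-- **Near-null vectors are near-minimisers under RH.**  Under `RiemannHypothesis` the
hypothesis of `riemannHypothesis_of_visible_near_minimisers` holds with `δ = 0`: for `a ≥ a₀` the
unit near-null vector `k_a` of part 4 is a near-minimiser with slack `s = Re Q(k_a) − ε(a) ≤ C`,
and `4 Z₁(k_a; ·) E(a) + s ≤ 5C`. -/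
theorem visible_near_minimisers_of_riemannHypothesis (hRH : RiemannHypothesis) :
    ∃ B a₀ : ℝ, ∀ a : ℝ, a₀ ≤ a → ∃ (g k : ℝ → ℂ) (A s : ℝ), IsWeilTest g ∧
      tsupport g ⊆ Icc (-a) a ∧ ∫ t, ‖g t‖ ^ 2 = 1 ∧ 0 ≤ s ∧
      (weilQuadratic g).re ≤ weilGroundEnergy a + s ∧ IsWeilTest k ∧ tsupport k ⊆ Icc (-a) a ∧
      (∀ T : ℝ, ∑ᶠ ρ ∈ weilZeroIndex T, (riemannZetaZeroOrder ρ : ℝ) * ‖weilMellin k ρ‖ ≤ A) ∧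
      4 * (A * (Real.exp (a / 2) * Real.sqrt (2 * a))) + s ≤ B ∧ ∫ t, ‖g t - k t‖ ^ 2 ≤ 0 := by
  obtain ⟨C, a₁, hC, h⟩ := exists_unit_nearNull_window
  refine ⟨5 * C, max a₁ 1, fun a ha ↦ ?_⟩
  have ha₁ : a₁ ≤ a := (le_max_left _ _).trans ha
  have ha0 : 0 < a := by linarith [le_max_right a₁ 1]
  obtain ⟨k, hk, hks, hk1, hZ⟩ := h a ha₁
  have hE0 : 0 < Real.exp (a / 2) * Real.sqrt (2 * a) := by positivity
  have hA : ∀ T : ℝ, ∑ᶠ ρ ∈ weilZeroIndex T, (riemannZetaZeroOrder ρ : ℝ) * ‖weilMellin k ρ‖ ≤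
      C / (Real.exp (a / 2) * Real.sqrt (2 * a)) := fun T ↦ by
    rw [le_div_iff₀ hE0]
    exact hZ T
  have hQ : ‖weilQuadratic k‖ ≤ C := by
    have h1 := norm_weilQuadratic_le_of_zeroSumAbs_le hk hks ha0.le hA
    rw [hk1, Real.sqrt_one, mul_one, div_mul_cancel₀ C hE0.ne'] at h1
    exact h1
  have hre : (weilQuadratic k).re ≤ C :=
    (le_abs_self _).trans ((Complex.abs_re_le_norm _).trans hQ)
  have hε0 : 0 ≤ weilGroundEnergy a := weilGroundEnergy_nonneg_of_riemannHypothesis hRH ha0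
  have hεle : weilGroundEnergy a ≤ (weilQuadratic k).re :=
    weilGroundEnergy_le_re_weilQuadratic hk hks hk1
  refine ⟨k, k, C / (Real.exp (a / 2) * Real.sqrt (2 * a)),
    (weilQuadratic k).re - weilGroundEnergy a, hk, hks, hk1, by linarith, by linarith, hk, hks,
    hA, ?_, by simp⟩
  rw [div_mul_cancel₀ C hE0.ne']
  linarith

/-- **The visibility criterion is an equivalence (bounded form).**  `RiemannHypothesis` holds if
and only if for some `δ < 1`, `B`, `a₀` and every `a ≥ a₀` there are a normalised test `g` on
`[-a, a]` and `s ≥ 0` with `Re Q(g) ≤ ε(a) + s`, and a window test `k` with `Z₁(k; ·) ≤ A`,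
`4 A e^{a/2}√(2a) + s ≤ B` and `‖g − k‖₂² ≤ δ`. -/
theorem riemannHypothesis_iff_visible_near_minimisers :
    RiemannHypothesis ↔ ∃ δ : ℝ, δ < 1 ∧ ∃ B a₀ : ℝ, ∀ a : ℝ, a₀ ≤ a →
      ∃ (g k : ℝ → ℂ) (A s : ℝ), IsWeilTest g ∧ tsupport g ⊆ Icc (-a) a ∧
      ∫ t, ‖g t‖ ^ 2 = 1 ∧ 0 ≤ s ∧ (weilQuadratic g).re ≤ weilGroundEnergy a + s ∧
      IsWeilTest k ∧ tsupport k ⊆ Icc (-a) a ∧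
      (∀ T : ℝ, ∑ᶠ ρ ∈ weilZeroIndex T, (riemannZetaZeroOrder ρ : ℝ) * ‖weilMellin k ρ‖ ≤ A) ∧
      4 * (A * (Real.exp (a / 2) * Real.sqrt (2 * a))) + s ≤ B ∧ ∫ t, ‖g t - k t‖ ^ 2 ≤ δ := by
  constructor
  · intro hRH
    obtain ⟨B, a₀, h⟩ := visible_near_minimisers_of_riemannHypothesis hRH
    exact ⟨0, zero_lt_one, B, a₀, h⟩
  · rintro ⟨δ, hδ, B, a₀, h⟩
    exact riemannHypothesis_of_visible_near_minimisers hδ h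

/-- **The visibility criterion is an equivalence (subexponential form).**  `RiemannHypothesis`
holds if and only if for some `δ < 1` and every `κ > 0` there are `B, a₀` such that every window
`a ≥ a₀` carries a normalised near-minimiser `g` (slack `s`) within `L²`-distance `√δ` of a window
test `k` with `4 Z₁(k; ·) e^{a/2}√(2a) + s ≤ B e^{κa}`. -/
theorem riemannHypothesis_iff_visible_near_minimisers_subexp :
    RiemannHypothesis ↔ ∃ δ : ℝ, δ < 1 ∧ ∀ κ : ℝ, 0 < κ → ∃ B a₀ : ℝ, ∀ a : ℝ, a₀ ≤ a →
      ∃ (g k : ℝ → ℂ) (A s : ℝ), IsWeilTest g ∧ tsupport g ⊆ Icc (-a) a ∧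
      ∫ t, ‖g t‖ ^ 2 = 1 ∧ 0 ≤ s ∧ (weilQuadratic g).re ≤ weilGroundEnergy a + s ∧
      IsWeilTest k ∧ tsupport k ⊆ Icc (-a) a ∧
      (∀ T : ℝ, ∑ᶠ ρ ∈ weilZeroIndex T, (riemannZetaZeroOrder ρ : ℝ) * ‖weilMellin k ρ‖ ≤ A) ∧
      4 * (A * (Real.exp (a / 2) * Real.sqrt (2 * a))) + s ≤ B * Real.exp (κ * a) ∧
      ∫ t, ‖g t - k t‖ ^ 2 ≤ δ := by
  constructor
  · intro hRH
    obtain ⟨B, a₀, h⟩ := visible_near_minimisers_of_riemannHypothesis hRH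
    refine ⟨0, zero_lt_one, fun κ hκ ↦ ⟨max B 0, max a₀ 0, fun a ha ↦ ?_⟩⟩
    obtain ⟨g, k, A, s, hg, hgs, hg1, hs, hgap, hk, hks, hA, hAB, hΔ⟩ :=
      h a ((le_max_left _ _).trans ha)
    have ha0 : 0 ≤ a := (le_max_right _ _).trans ha
    have hexp : 1 ≤ Real.exp (κ * a) := Real.one_le_exp (by positivity)
    refine ⟨g, k, A, s, hg, hgs, hg1, hs, hgap, hk, hks, hA, ?_, hΔ⟩
    calc 4 * (A * (Real.exp (a / 2) * Real.sqrt (2 * a))) + s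
        ≤ max B 0 := hAB.trans (le_max_left _ _)
      _ = max B 0 * 1 := (mul_one _).symm
      _ ≤ max B 0 * Real.exp (κ * a) := mul_le_mul_of_nonneg_left hexp (le_max_right _ _)
  · rintro ⟨δ, hδ, h⟩
    exact riemannHypothesis_of_visible_near_minimisers_subexp hδ h

/-- Summit form: `Summit.RiemannHypothesis` is equivalent to the visible-near-minimiser
condition (bounded form). -/
theorem summit_iff_visible_near_minimisers :
    Summit.RiemannHypothesis ↔ ∃ δ : ℝ, δ < 1 ∧ ∃ B a₀ : ℝ, ∀ a : ℝ, a₀ ≤ a →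
      ∃ (g k : ℝ → ℂ) (A s : ℝ), IsWeilTest g ∧ tsupport g ⊆ Icc (-a) a ∧
      ∫ t, ‖g t‖ ^ 2 = 1 ∧ 0 ≤ s ∧ (weilQuadratic g).re ≤ weilGroundEnergy a + s ∧
      IsWeilTest k ∧ tsupport k ⊆ Icc (-a) a ∧
      (∀ T : ℝ, ∑ᶠ ρ ∈ weilZeroIndex T, (riemannZetaZeroOrder ρ : ℝ) * ‖weilMellin k ρ‖ ≤ A) ∧
      4 * (A * (Real.exp (a / 2) * Real.sqrt (2 * a))) + s ≤ B ∧ ∫ t, ‖g t - k t‖ ^ 2 ≤ δ :=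
  riemannHypothesis_iff_visible_near_minimisers

end Equivalence

end Summit.RiemannHypothesis.RiemannHypothesis.Theorems
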